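import Literature.MathematicalPhysics.QuantumManyBody.PeriodicBoseGasBox
import Literature.MathematicalPhysics.QuantumManyBody.PeriodicBoseGasLemma33
import Literature.MathematicalPhysics.QuantumManyBody.PeriodicBoseGasThm31
import Mathlib.Algebra.Module.ZLattice.Basic
import Mathlib.MeasureTheory.Group.FundamentalDomain
import HarnessLib

/-!
# Fournais 2020, (3.15)–(3.17): the sliding-box bound from Theorem 2.1

Topic `Literature/MathematicalPhysics/QuantumManyBody` (provefact
`Literature.MathematicalPhysics.QuantumManyBody.BoseGas.Fournais2020_condensation`). We prove
`Fournais2020_eq317_of_thm21 : Fournais2020_thm21 → Fournais2020_eq317`: the display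
[Fournais2020, (3.17)] — for all `N`, all `u ∈ Ω` and all periodic `N`-body states `Ψ`,
`⟨Ψ, (∑ᵢ T_u^{(i)} + W_{u,N}) Ψ⟩ ≥ -4πρ_μ²aℓ³(1 + C₀(ρ_μa³)^{1/2})` — follows from the small-box
theorem [Fournais2020, Thm. 2.1] (`Fournais2020_thm21`, `PeriodicBoseGasBox.lean`) applied on
every particle-number sector of the box `Λ(u)`.

## The argument ((3.15)–(3.16), "where we have used the natural identifications")

Fix `u ∈ Ω` and write `Λ = Λ(u)`, `2ℓ < L`.

1. *Choice of the fundamental cell.* All integrands are `Lℤ³`-periodic in every particle, so the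
   cell `Ω^N = [0,L)^{3N}` may be replaced by `Ω'^N`, `Ω' = u - (L/2)𝟙 + [0,L)³ ⊇ Λ(u)`
   (`lintegral_cellN_comp_add`: `[0,L)^{3N}` and its translates are fundamental domains of
   `(Lℤ³)^N`, `ZSpan.isAddFundamentalDomain`).
2. *Un-periodisation.* On `Ω'`, `χ_u^per = χ_u`; for `x, y ∈ Λ(u)`, `W^per(x-y) = W(x-y)` (range
   `R < ℓ`, `2ℓ < L`), and `∫_Ω w^per_{1,u}(x,y) dy = ∫_{ℝ³} w_{1,u}(x,y) dy`: on `Ω'^N` the periodic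
   `W_{u,N}` (3.11) is the box potential of (2.6).
3. *Particle decomposition.* `Ω'^N = ⊔_{S ⊆ {1..N}} Λ^S × (Ω' ∖ Λ)^{S^c}`; for `Y ∈ (Ω' ∖ Λ)^{S^c}`
   the function `Φ_{S,Y} = Ψ(·, Y)` on `Λ^S` is symmetric, and `T_u^{(i)}`, `w_u(xᵢ,xⱼ)`,
   `w_{1,u}(xᵢ,y)` only see particles in `Λ`: Thm. 2.1 on the `|S|`-particle sector, integrated
   over `Y` and summed over `S`, is (3.17) (the kinetic bookkeeping uses that the `i`-th slice
   form does not depend on `xᵢ`: `ℓ⁻³∑_{S∋i}∫_{D_S} = L⁻³∫_{Ω'^N}`).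

Main result: `Fournais2020_eq317_of_thm21`. Together with `PeriodicBoseGasThm31.lean` and
`PeriodicBoseGasKineticMultiplierProofs.lean` (`Fournais2020_lemma33_holds`), this reduces
`Fournais2020_condensation` [Fournais2020, Thm. 1.2] to the two named facts
`LSSY2005_scatteringSolution` (LSSY App. C) and `Fournais2020_thm21` (= [BFS2020, Thm. 6.1]).
The file is definition-free: the cells of the partition, the enumeration `e_S : Fin |S| ≃o S`,
the splitting equivalence and the shifted cell are local notations (`piSel[S, A, B]`, `eS[S]`,
`split[S]`, `cellAt[L, u]`).

## References

* [Fournais2020] S. Fournais, *Length scales for BEC in the dilute Bose gas*, arXiv:2011.00309,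
  EMS Ser. Congr. Rep. 18 (2021): Thm. 2.1, (2.6), (3.14)–(3.17).
-/

noncomputable section

open MeasureTheory Filter Set WithLp
open scoped ENNReal NNReal Topology Pointwise

namespace Literature.MathematicalPhysics.QuantumManyBody.BoseGas

variable {N : ℕ} {L : ℝ}

/-! ### Step 1: the cell `[0,L)^{3N}` is a fundamental domain of `(Lℤ³)^N` -/

section FundamentalDomain

/-- `L e_k = L • e_k`. [folklore] -/
theorem smul_single_one (k : Fin 3) (L : ℝ) :
    L • EuclideanSpace.single k (1 : ℝ) = EuclideanSpace.single k L := by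
  ext j
  by_cases h : j = k
  · subst h; simp
  · simp [h]

set_option quotPrecheck false in
/-- The basis `(L e_{i,k})` of `(ℝ³)^N` whose `ℤ`-span is the period lattice `(Lℤ³)^N`
(local notation; `hL : 0 < L`). [folklore] -/
local notation "latticeBasisN[" N ", " hL "]" =>
  (Pi.basis fun _ : Fin N =>
    (EuclideanSpace.basisFun (Fin 3) ℝ).toBasis.unitsSMul fun _ : Fin 3 => Units.mk0 _ (ne_of_gt hL) :
    Module.Basis (Σ _ : Fin N, Fin 3) ℝ (Config N))

/-- `latticeBasisN` vectors are `L e_k` in particle `i`. [folklore] -/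
theorem latticeBasisN_apply (hL : 0 < L) (ik : Σ _ : Fin N, Fin 3) :
    latticeBasisN[N, hL] ik = Pi.single ik.1 (EuclideanSpace.single ik.2 L) := by
  classical
  rw [Pi.basis_apply]
  congr 1
  rw [Module.Basis.unitsSMul_apply, ← smul_single_one]
  simp [Units.smul_def]

/-- Coordinates in `latticeBasisN`: `L⁻¹ X i k`. [folklore] -/
theorem latticeBasisN_repr (hL : 0 < L) (X : Config N) (ik : Σ _ : Fin N, Fin 3) :
    (latticeBasisN[N, hL]).repr X ik = L⁻¹ * X ik.1 ik.2 := by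
  rw [Pi.basis_repr]
  simp [Units.smul_def]

/-- The fundamental domain of `latticeBasisN` is the cell `[0,L)^{3N}`. [folklore] -/
theorem fundamentalDomain_latticeBasisN (hL : 0 < L) :
    ZSpan.fundamentalDomain (latticeBasisN[N, hL]) = cellN N L := by
  ext X
  simp only [ZSpan.mem_fundamentalDomain, latticeBasisN_repr hL, Set.mem_Ico, cellN, cell,
    Set.mem_setOf_eq, Sigma.forall]
  refine forall_congr' fun i => forall_congr' fun k => ?_
  rw [← div_eq_inv_mul, le_div_iff₀ hL, div_lt_iff₀ hL, zero_mul, one_mul]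

/-- A function periodic in every particle and axis is invariant under the subgroup generated by
the period vectors. [folklore] -/
theorem periodic_closure (hL : 0 < L) {G : Config N → ℝ≥0∞}
    (hG : ∀ (X : Config N) (i : Fin N) (k : Fin 3),
      G (X + Pi.single i (EuclideanSpace.single k L)) = G X)
    {g : Config N} (hg : g ∈ AddSubgroup.closure (Set.range (latticeBasisN[N, hL])))
    (X : Config N) : G (g + X) = G X := by
  induction hg using AddSubgroup.closure_induction generalizing X with
  | mem v hv =>
      obtain ⟨ik, rfl⟩ := hv
      rw [latticeBasisN_apply hL, add_comm]
      exact hG X ik.1 ik.2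
  | zero => rw [zero_add]
  | add v w _ _ ihv ihw => rw [add_assoc, ihv, ihw]
  | neg v _ ihv =>
      have h := ihv (-v + X)
      rw [← add_assoc, add_neg_cancel, zero_add] at h
      exact h.symm

/-- A function periodic in every particle and axis is invariant under the lattice `(Lℤ³)^N`.
[folklore] -/
theorem periodic_zspan (hL : 0 < L) {G : Config N → ℝ≥0∞}
    (hG : ∀ (X : Config N) (i : Fin N) (k : Fin 3),
      G (X + Pi.single i (EuclideanSpace.single k L)) = G X)
    (g : (Submodule.span ℤ (Set.range (latticeBasisN[N, hL]))).toAddSubgroup) (X : Config N) :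
    G (g +ᵥ X) = G X := by
  rw [AddSubgroup.vadd_def, vadd_eq_add]
  refine periodic_closure hL hG ?_ X
  rw [← Submodule.span_int_eq_addSubgroupClosure]
  exact g.2

/-- **Shift of the fundamental cell**: for `G ≥ 0` periodic in every particle and axis and any
translation `C`, `∫_{[0,L)^{3N}} G(X + C) dX = ∫_{[0,L)^{3N}} G(X) dX`. [folklore] -/
theorem lintegral_cellN_comp_add (hL : 0 < L) {G : Config N → ℝ≥0∞}
    (hG : ∀ (X : Config N) (i : Fin N) (k : Fin 3),
      G (X + Pi.single i (EuclideanSpace.single k L)) = G X)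
    (C : Config N) :
    ∫⁻ X in cellN N L, G (X + C) = ∫⁻ X in cellN N L, G X := by
  set Γ := (Submodule.span ℤ (Set.range (latticeBasisN[N, hL]))).toAddSubgroup
  haveI : Countable Γ := by
    change Countable (Submodule.span ℤ (Set.range (latticeBasisN[N, hL])))
    infer_instance
  have hF : IsAddFundamentalDomain Γ (cellN N L) volume := by
    rw [← fundamentalDomain_latticeBasisN hL]
    exact ZSpan.isAddFundamentalDomain' _ _
  -- the translate `C + [0,L)^{3N}` is a fundamental domain as well
  let f : Config N ≃ᵐ Config N := MeasurableEquiv.addRight C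
  have hF' : IsAddFundamentalDomain Γ ((f : Config N ≃ Config N) '' cellN N L) volume := by
    refine hF.image_of_equiv (f : Config N ≃ Config N) ?_ (Equiv.refl Γ) fun g X => ?_
    · exact ((measurePreserving_add_right volume C).symm f).quasiMeasurePreserving
    · change (g +ᵥ X) + C = g +ᵥ (X + C)
      rw [AddSubgroup.vadd_def, AddSubgroup.vadd_def, vadd_eq_add, vadd_eq_add, add_assoc]
  have hinv := periodic_zspan hL hG
  have himage : ((f : Config N ≃ Config N) '' cellN N L) = (fun X => X + C) '' cellN N L := rfl
  have hmeas : MeasurableSet ((fun X : Config N => X + C) '' cellN N L) :=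
    (MeasurableEquiv.addRight C).measurableEmbedding.measurableSet_image.2 (measurableSet_cellN N L)
  rw [hF.setLIntegral_eq hF' G hinv, himage, ← lintegral_indicator hmeas,
    ← lintegral_indicator (measurableSet_cellN N L),
    ← lintegral_add_right_eq_self (((fun X : Config N => X + C) '' cellN N L).indicator G) C]
  refine lintegral_congr fun X => ?_
  by_cases hX : X ∈ cellN N L
  · rw [indicator_of_mem hX, indicator_of_mem (Set.mem_image_of_mem _ hX)]
  · rw [indicator_of_notMem hX, indicator_of_notMem]
    rintro ⟨X', hX', hXX'⟩
    exact hX (by rwa [add_right_cancel hXX'] at hX')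

end FundamentalDomain

/-! ### Periodicity of the integrands of (3.17) in every particle -/

section Periodicity

variable {χ : Space → ℝ} {ℓ : ℝ} {v : ℝ → ℝ≥0∞} {ω : Space → ℝ}

/-- `L e_k` is the lattice vector of `e_k ∈ ℤ³`. [folklore] -/
theorem latticeVec_single (L : ℝ) (k : Fin 3) :
    latticeVec L (Pi.single k 1) = EuclideanSpace.single k L := by
  ext j
  rw [latticeVec_apply, PiLp.single_apply]
  by_cases h : j = k
  · subst h; simp
  · simp [h]

/-- `χ_u^per` is `Lℤ³`-periodic. [cite: Fournais2020, (3.7)] -/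
theorem locFunPer_add_latticeVec (χ : Space → ℝ) (ℓ L : ℝ) (u x : Space) (m : Fin 3 → ℤ) :
    locFunPer χ ℓ L u (x + latticeVec L m) = locFunPer χ ℓ L u x := by
  unfold locFunPer
  conv_rhs => rw [← (Equiv.addLeft m).tsum_eq]
  refine tsum_congr fun n => ?_
  simp only [Equiv.coe_addLeft, latticeVec_add, add_assoc]

/-- `W^per` is `Lℤ³`-periodic. [cite: Fournais2020, (3.7)] -/
theorem bigWPer_add_latticeVec (v : ℝ → ℝ≥0∞) (χ : Space → ℝ) (ℓ L : ℝ) (x : Space)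
    (m : Fin 3 → ℤ) : bigWPer v χ ℓ L (x + latticeVec L m) = bigWPer v χ ℓ L x := by
  unfold bigWPer
  conv_rhs => rw [← (Equiv.addLeft m).tsum_eq]
  refine tsum_congr fun n => ?_
  simp only [Equiv.coe_addLeft, latticeVec_add, add_assoc]

/-- `W₁^per` is `Lℤ³`-periodic. [cite: Fournais2020, (3.7)] -/
theorem bigW₁Per_add_latticeVec (v : ℝ → ℝ≥0∞) (ω : Space → ℝ) (χ : Space → ℝ) (ℓ L : ℝ)
    (x : Space) (m : Fin 3 → ℤ) :
    bigW₁Per v ω χ ℓ L (x + latticeVec L m) = bigW₁Per v ω χ ℓ L x := by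
  unfold bigW₁Per
  conv_rhs => rw [← (Equiv.addLeft m).tsum_eq]
  refine tsum_congr fun n => ?_
  simp only [Equiv.coe_addLeft, latticeVec_add, add_assoc]

/-- `w_u^per` is `Lℤ³`-periodic in each variable. [cite: Fournais2020, (3.9)] -/
theorem pairLocPer_add_latticeVec (v : ℝ → ℝ≥0∞) (χ : Space → ℝ) (ℓ L : ℝ) (u x y : Space)
    (m n : Fin 3 → ℤ) :
    pairLocPer v χ ℓ L u (x + latticeVec L m) (y + latticeVec L n) = pairLocPer v χ ℓ L u x y := by
  unfold pairLocPer
  rw [locFunPer_add_latticeVec, locFunPer_add_latticeVec,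
    show x + latticeVec L m - (y + latticeVec L n) = x - y + latticeVec L (m - n) by
      rw [latticeVec_sub]; abel,
    bigWPer_add_latticeVec]

/-- `w_{1,u}^per` is `Lℤ³`-periodic in each variable. [cite: Fournais2020, (3.9)] -/
theorem pairLoc₁Per_add_latticeVec (v : ℝ → ℝ≥0∞) (ω : Space → ℝ) (χ : Space → ℝ) (ℓ L : ℝ)
    (u x y : Space) (m n : Fin 3 → ℤ) :
    pairLoc₁Per v ω χ ℓ L u (x + latticeVec L m) (y + latticeVec L n) =
      pairLoc₁Per v ω χ ℓ L u x y := by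
  unfold pairLoc₁Per
  rw [locFunPer_add_latticeVec, locFunPer_add_latticeVec,
    show x + latticeVec L m - (y + latticeVec L n) = x - y + latticeVec L (m - n) by
      rw [latticeVec_sub]; abel,
    bigW₁Per_add_latticeVec]

/-- The coordinates of `X + eⱼ ⊗ (L e_k)` are lattice translates of those of `X`. [folklore] -/
theorem exists_apply_add_single (X : Config N) (j : Fin N) (k : Fin 3) (L : ℝ) (i : Fin N) :
    ∃ m : Fin 3 → ℤ, (X + Pi.single j (EuclideanSpace.single k L) : Config N) i =
      X i + latticeVec L m := by
  by_cases h : i = j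
  · subst h
    exact ⟨Pi.single k 1, by rw [latticeVec_single]; simp⟩
  · exact ⟨0, by simp [h, latticeVec_zero]⟩

/-- `X ↦ ∑_{i<j} w_u^per(xᵢ,xⱼ)` is periodic in every particle. [cite: Fournais2020, (3.11)] -/
theorem repLocN_add_single (v : ℝ → ℝ≥0∞) (χ : Space → ℝ) (ℓ L : ℝ) (u : Space) (X : Config N)
    (j : Fin N) (k : Fin 3) :
    repLocN v χ ℓ L u (X + Pi.single j (EuclideanSpace.single k L)) = repLocN v χ ℓ L u X := by
  unfold repLocN
  refine Finset.sum_congr rfl fun i _ => Finset.sum_congr rfl fun i' _ => ?_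
  obtain ⟨m, hm⟩ := exists_apply_add_single X j k L i
  obtain ⟨n, hn⟩ := exists_apply_add_single X j k L i'
  rw [hm, hn, pairLocPer_add_latticeVec]

/-- `X ↦ ρ_μ∑ᵢ∫_Ω w_{1,u}^per(xᵢ,y)dy` is periodic in every particle. [cite: Fournais2020, (3.11)] -/
theorem attrLocN_add_single (v : ℝ → ℝ≥0∞) (ω : Space → ℝ) (χ : Space → ℝ) (ℓ L ρμ : ℝ)
    (u : Space) (X : Config N) (j : Fin N) (k : Fin 3) :
    attrLocN v ω χ ℓ L ρμ u (X + Pi.single j (EuclideanSpace.single k L)) =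
      attrLocN v ω χ ℓ L ρμ u X := by
  unfold attrLocN
  congr 1
  refine Finset.sum_congr rfl fun i _ => ?_
  obtain ⟨m, hm⟩ := exists_apply_add_single X j k L i
  rw [hm]
  refine lintegral_congr fun y => ?_
  have h := pairLoc₁Per_add_latticeVec v ω χ ℓ L u (X i) y m 0
  rwa [latticeVec_zero, add_zero] at h

/-- The `i`-th slice through `X + eⱼ ⊗ (L e_k)` of a periodic `Ψ` is the `i`-th slice through `X`.
[folklore] -/
theorem PeriodicTrialState.slice_add_single (Ψ : PeriodicTrialState N L) (X : Config N)
    (i j : Fin N) (k : Fin 3) :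
    (fun x => Ψ.ψ (Function.update (X + Pi.single j (EuclideanSpace.single k L)) i x)) =
      fun x => Ψ.ψ (Function.update X i x) := by
  funext x
  by_cases h : j = i
  · subst h
    congr 1
    funext i'
    by_cases h' : i' = j
    · subst h'; simp
    · simp [h']
  · have : Function.update (X + Pi.single j (EuclideanSpace.single k L)) i x =
        Function.update X i x + Pi.single j (EuclideanSpace.single k L) := by
      funext i'
      by_cases h' : i' = i
      · subst h'; simp [Ne.symm h]
      · by_cases h'' : i' = j
        · subst h''; simp [h']
        · simp [h', h'']
    rw [this, Ψ.periodic]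

end Periodicity

/-! ### Step 2: un-periodisation on the shifted cell `Ω' ⊇ Λ(u)` -/

section Unperiodisation

variable {χ : Space → ℝ} {ℓ : ℝ} {v : ℝ → ℝ≥0∞} {ω : Space → ℝ}

/-- A point within `L/2` of `u` in every coordinate has no lattice translate in `Λ(u)` other than
itself (`ℓ < L`): `χ_u(x + Ln) = 0` for `n ≠ 0`. [cite: Fournais2020, (3.6)–(3.7)] -/
theorem locFun_add_latticeVec_eq_zero (hχ : IsLocalizationFunction χ) (hℓ : 0 < ℓ) (hℓL : ℓ < L)
    {u x : Space} (hx : ∀ k, |x k - u k| ≤ L / 2) {n : Fin 3 → ℤ} (hn : n ≠ 0) :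
    locFun χ ℓ u (x + latticeVec L n) = 0 := by
  refine locFun_eq_zero_of_not_mem hχ hℓ fun hmem => hn ?_
  funext k
  by_contra hk
  have h1 := hmem k
  simp only [PiLp.add_apply, latticeVec_apply, Set.mem_Icc] at h1
  have h2 := hx k
  rw [abs_le] at h2
  have hL : 0 < L := by linarith
  have hnk : (1 : ℝ) ≤ |(n k : ℝ)| := by
    rw [← Int.cast_abs, ← Int.cast_one, Int.cast_le]; exact Int.one_le_abs hk
  have h3 : L ≤ |L * (n k : ℝ)| := by
    rw [abs_mul, abs_of_pos hL]; nlinarith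
  have h4 : |L * (n k : ℝ)| ≤ |x k + L * n k - u k| + |x k - u k| := by
    have := abs_sub (x k + L * n k - u k) (x k - u k)
    rwa [show x k + L * (n k : ℝ) - u k - (x k - u k) = L * n k by ring] at this
  have h5 : |x k + L * (n k : ℝ) - u k| ≤ ℓ / 2 := abs_le.2 ⟨by linarith [h1.1], by linarith [h1.2]⟩
  have h6 := hx k
  linarith

/-- On the shifted cell, `χ_u^per = χ_u`. [cite: Fournais2020, (3.6)–(3.7)] -/
theorem locFunPer_eq_locFun (hχ : IsLocalizationFunction χ) (hℓ : 0 < ℓ) (hℓL : ℓ < L)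
    {u x : Space} (hx : ∀ k, |x k - u k| ≤ L / 2) :
    locFunPer χ ℓ L u x = ENNReal.ofReal (locFun χ ℓ u x) := by
  unfold locFunPer
  rw [tsum_eq_single 0 fun n hn => by rw [locFun_add_latticeVec_eq_zero hχ hℓ hℓL hx hn,
    ENNReal.ofReal_zero], latticeVec_zero, add_zero]

/-- Points of `Λ(u)` are within `L/2` of `u` (`ℓ ≤ L`). [cite: Fournais2020, (3.4)] -/
theorem abs_sub_le_of_mem_slidingBox (hℓL : ℓ ≤ L) {u x : Space} (hx : x ∈ slidingBox ℓ u)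
    (k : Fin 3) : |x k - u k| ≤ L / 2 := by
  have h := hx k
  rw [Set.mem_Icc] at h
  rw [abs_le]; constructor <;> linarith

/-- For `z ∈ Λ(u) - Λ(u)` and `n ≠ 0`, `|z + Ln| > ℓ ≥ R`: the finite-range potential does not
see other periods (`2ℓ < L`). [cite: Fournais2020, (3.7)] -/
theorem v_norm_add_latticeVec_eq_zero {R : ℝ} (hv : ∀ r, R ≤ r → v r = 0) (hRℓ : R ≤ ℓ)
    (hL : 2 * ℓ < L) {z : Space} (hz : ∀ k, |z k| ≤ ℓ) {n : Fin 3 → ℤ} (hn : n ≠ 0) :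
    v ‖z + latticeVec L n‖ = 0 := by
  refine hv _ ?_
  obtain ⟨k, hk⟩ : ∃ k, n k ≠ 0 := by
    by_contra h; push Not at h; exact hn (funext h)
  have hℓ0 : (0 : ℝ) ≤ ℓ := (abs_nonneg _).trans (hz k)
  have hL0 : 0 < L := by linarith
  have hnk : (1 : ℝ) ≤ |(n k : ℝ)| := by
    rw [← Int.cast_abs, ← Int.cast_one, Int.cast_le]; exact Int.one_le_abs hk
  have h3 : L ≤ |L * (n k : ℝ)| := by rw [abs_mul, abs_of_pos hL0]; nlinarith
  have h4 : |L * (n k : ℝ)| - |z k| ≤ |z k + L * n k| := by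
    have := abs_sub_abs_le_abs_sub (L * (n k : ℝ)) (-(z k))
    rw [abs_neg, show L * (n k : ℝ) - -z k = z k + L * n k by ring] at this
    exact this
  calc R ≤ ℓ := hRℓ
    _ ≤ |z k + L * n k| := by linarith [hz k]
    _ = |(z + latticeVec L n) k| := by simp
    _ ≤ ‖z + latticeVec L n‖ := by
        have := PiLp.norm_apply_le (p := 2) (z + latticeVec L n) k
        rwa [Real.norm_eq_abs] at this

/-- Differences of points of `Λ(u)` have coordinates at most `ℓ`. [cite: Fournais2020, (3.4)] -/
theorem abs_sub_le_of_mem_slidingBox₂ {u x y : Space} (hx : x ∈ slidingBox ℓ u)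
    (hy : y ∈ slidingBox ℓ u) (k : Fin 3) : |(x - y) k| ≤ ℓ := by
  have h1 := hx k
  have h2 := hy k
  rw [Set.mem_Icc] at h1 h2
  rw [PiLp.sub_apply, abs_le]; constructor <;> linarith

/-- On `Λ(u) - Λ(u)`, `W^per = W`. [cite: Fournais2020, (3.7), (2.4)] -/
theorem bigWPer_eq_bigW {R : ℝ} (hv : ∀ r, R ≤ r → v r = 0) (hRℓ : R ≤ ℓ) (hL : 2 * ℓ < L)
    {z : Space} (hz : ∀ k, |z k| ≤ ℓ) : bigWPer v χ ℓ L z = bigW v χ ℓ z := by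
  unfold bigWPer
  rw [tsum_eq_single 0 fun n hn => by
    rw [bigW, v_norm_add_latticeVec_eq_zero hv hRℓ hL hz hn, ENNReal.zero_div],
    latticeVec_zero, add_zero]

/-- On `Λ(u) - Λ(u)`, `W₁^per = W₁`. [cite: Fournais2020, (3.7), (2.8)] -/
theorem bigW₁Per_eq_bigW₁ {R : ℝ} (hv : ∀ r, R ≤ r → v r = 0) (hRℓ : R ≤ ℓ) (hL : 2 * ℓ < L)
    {z : Space} (hz : ∀ k, |z k| ≤ ℓ) : bigW₁Per v ω χ ℓ L z = bigW₁ v ω χ ℓ z := by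
  unfold bigW₁Per
  rw [tsum_eq_single 0 fun n hn => by
    rw [bigW₁, v_norm_add_latticeVec_eq_zero hv hRℓ hL hz hn, zero_mul, ENNReal.zero_div],
    latticeVec_zero, add_zero]

/-- **Un-periodisation of the pair potential**: for `x, y` within `L/2` of `u` in every
coordinate, `w_u^per(x,y) = w_u(x,y)`. [cite: Fournais2020, (3.9), (3.16)] -/
theorem pairLocPer_eq_pairLoc (hχ : IsLocalizationFunction χ) {R : ℝ} (hv : ∀ r, R ≤ r → v r = 0)
    (hℓ : 0 < ℓ) (hRℓ : R ≤ ℓ) (hL : 2 * ℓ < L) {u x y : Space} (hx : ∀ k, |x k - u k| ≤ L / 2)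
    (hy : ∀ k, |y k - u k| ≤ L / 2) :
    pairLocPer v χ ℓ L u x y = pairLoc v χ ℓ u x y := by
  have hℓL : ℓ < L := by linarith
  unfold pairLocPer pairLoc
  rw [locFunPer_eq_locFun hχ hℓ hℓL hx, locFunPer_eq_locFun hχ hℓ hℓL hy]
  by_cases hxΛ : x ∈ slidingBox ℓ u
  · by_cases hyΛ : y ∈ slidingBox ℓ u
    · rw [bigWPer_eq_bigW hv hRℓ hL (abs_sub_le_of_mem_slidingBox₂ hxΛ hyΛ)]
    · simp [locFun_eq_zero_of_not_mem hχ hℓ hyΛ]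
  · simp [locFun_eq_zero_of_not_mem hχ hℓ hxΛ]

/-- `W` is measurable. [cite: Fournais2020, (2.4)] -/
theorem measurable_bigW (hvm : Measurable v) (hχ : IsLocalizationFunction χ) (ℓ : ℝ) :
    Measurable (bigW v χ ℓ) := by
  unfold bigW
  exact (hvm.comp measurable_norm).div
    (((measurable_selfConv hχ).comp (measurable_const_smul _)).ennreal_ofReal)

/-- `W₁` is measurable. [cite: Fournais2020, (2.8)] -/
theorem measurable_bigW₁ (hvm : Measurable v) (hω : Measurable ω) (hχ : IsLocalizationFunction χ)
    (ℓ : ℝ) : Measurable (bigW₁ v ω χ ℓ) := by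
  unfold bigW₁
  exact ((hvm.comp measurable_norm).mul ((measurable_const.sub hω).ennreal_ofReal)).div
    (((measurable_selfConv hχ).comp (measurable_const_smul _)).ennreal_ofReal)

/-- `y ↦ χ_u(y)` is measurable. [cite: Fournais2020, (3.6)] -/
theorem measurable_locFun_right (hχ : IsLocalizationFunction χ) (ℓ : ℝ) (u : Space) :
    Measurable fun y => locFun χ ℓ u y := by
  unfold locFun
  exact hχ.measurable.comp (by fun_prop)

/-- `(x, y) ↦ w₁(x, y)` is measurable. [cite: Fournais2020, (2.8)] -/
theorem measurable_pairLoc₁₂ (hvm : Measurable v) (hω : Measurable ω) (hχ : IsLocalizationFunction χ)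
    (ℓ : ℝ) (u : Space) : Measurable fun q : Space × Space => pairLoc₁ v ω χ ℓ u q.1 q.2 := by
  unfold pairLoc₁
  exact (((measurable_locFun_right hχ ℓ u).comp measurable_fst).ennreal_ofReal.mul
    ((measurable_bigW₁ hvm hω hχ ℓ).comp (measurable_fst.sub measurable_snd))).mul
    ((measurable_locFun_right hχ ℓ u).comp measurable_snd).ennreal_ofReal

/-- `(x, y) ↦ w(x, y)` is measurable. [cite: Fournais2020, (2.8)] -/
theorem measurable_pairLoc₂ (hvm : Measurable v) (hχ : IsLocalizationFunction χ) (ℓ : ℝ)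
    (u : Space) : Measurable fun q : Space × Space => pairLoc v χ ℓ u q.1 q.2 := by
  unfold pairLoc
  exact (((measurable_locFun_right hχ ℓ u).comp measurable_fst).ennreal_ofReal.mul
    ((measurable_bigW hvm hχ ℓ).comp (measurable_fst.sub measurable_snd))).mul
    ((measurable_locFun_right hχ ℓ u).comp measurable_snd).ennreal_ofReal

/-- For `x ∈ Λ(u)`: `W₁^per(x - y) χ_u^per(y) = ∑ₙ W₁(x - (y + Ln)) χ_u(y + Ln)` — each translate of
`y` in `Λ(u)` only sees the period of `W₁` centred at it. [cite: Fournais2020, (3.7)–(3.9)] -/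
theorem bigW₁Per_mul_locFunPer (hχ : IsLocalizationFunction χ) {R : ℝ} (hv : ∀ r, R ≤ r → v r = 0)
    (hℓ : 0 < ℓ) (hRℓ : R ≤ ℓ) (hL : 2 * ℓ < L) {u x : Space} (hxΛ : x ∈ slidingBox ℓ u)
    (y : Space) :
    bigW₁Per v ω χ ℓ L (x - y) * locFunPer χ ℓ L u y =
      ∑' n : Fin 3 → ℤ, bigW₁ v ω χ ℓ (x - (y + latticeVec L n)) *
        ENNReal.ofReal (locFun χ ℓ u (y + latticeVec L n)) := by
  unfold locFunPer
  rw [← ENNReal.tsum_mul_left]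
  refine tsum_congr fun n => ?_
  by_cases hyn : y + latticeVec L n ∈ slidingBox ℓ u
  · rw [show x - y = (x - (y + latticeVec L n)) + latticeVec L n by abel, bigW₁Per_add_latticeVec,
      bigW₁Per_eq_bigW₁ hv hRℓ hL (abs_sub_le_of_mem_slidingBox₂ hxΛ hyn)]
  · rw [locFun_eq_zero_of_not_mem hχ hℓ hyn, ENNReal.ofReal_zero, mul_zero, mul_zero]

/-- **Un-periodisation of the one-body potential**: for `x` within `L/2` of `u` in every
coordinate, `∫_Ω w^per_{1,u}(x,y) dy = ∫_{ℝ³} w_{1,u}(x,y) dy` (tiling of `ℝ³` by the translates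
of `Ω`). [cite: Fournais2020, (3.9)–(3.11), (3.16)] -/
theorem lintegral_cell_pairLoc₁Per (hχ : IsLocalizationFunction χ) {R : ℝ} (hvm : Measurable v)
    (hv : ∀ r, R ≤ r → v r = 0) (hω : Measurable ω) (hℓ : 0 < ℓ) (hRℓ : R ≤ ℓ) (hL : 2 * ℓ < L)
    {u x : Space} (hx : ∀ k, |x k - u k| ≤ L / 2) :
    ∫⁻ y in cell L, pairLoc₁Per v ω χ ℓ L u x y = ∫⁻ y, pairLoc₁ v ω χ ℓ u x y := by
  have hℓL : ℓ < L := by linarith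
  have hL0 : 0 < L := by linarith
  by_cases hxΛ : x ∈ slidingBox ℓ u
  · have hfm : Measurable (pairLoc₁ v ω χ ℓ u x) :=
      Measurable.of_uncurry_left (f := pairLoc₁ v ω χ ℓ u) (measurable_pairLoc₁₂ hvm hω hχ ℓ u)
    have hper : ∀ y, pairLoc₁Per v ω χ ℓ L u x y =
        ∑' n : Fin 3 → ℤ, pairLoc₁ v ω χ ℓ u x (y + latticeVec L n) := by
      intro y
      unfold pairLoc₁Per
      rw [locFunPer_eq_locFun hχ hℓ hℓL hx, mul_assoc, bigW₁Per_mul_locFunPer hχ hv hℓ hRℓ hL hxΛ y,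
        ← ENNReal.tsum_mul_left]
      refine tsum_congr fun n => ?_
      unfold pairLoc₁
      rw [mul_assoc]
    calc ∫⁻ y in cell L, pairLoc₁Per v ω χ ℓ L u x y
        = ∫⁻ y in cell L, ∑' n : Fin 3 → ℤ, pairLoc₁ v ω χ ℓ u x (y + latticeVec L n) :=
          lintegral_congr fun y => hper y
      _ = ∑' n : Fin 3 → ℤ, ∫⁻ y in cell L, pairLoc₁ v ω χ ℓ u x (y + latticeVec L n) :=
          lintegral_tsum fun n => (hfm.comp (measurable_id.add_const _)).aemeasurable
      _ = ∑' n : Fin 3 → ℤ, ∫⁻ y in cell L, pairLoc₁ v ω χ ℓ u x (y - latticeVec L n) := by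
          rw [← (Equiv.neg _).tsum_eq]
          refine tsum_congr fun n => ?_
          simp only [Equiv.neg_apply, latticeVec_neg, sub_eq_add_neg]
      _ = ∫⁻ y, pairLoc₁ v ω χ ℓ u x y :=
          tsum_lintegral_cell_sub_latticeVec hL0 fun y => pairLoc₁ v ω χ ℓ u x y
  · have h0 : locFun χ ℓ u x = 0 := locFun_eq_zero_of_not_mem hχ hℓ hxΛ
    have h1 : ∀ y, pairLoc₁Per v ω χ ℓ L u x y = 0 := fun y => by
      unfold pairLoc₁Per
      rw [locFunPer_eq_locFun hχ hℓ hℓL hx, h0]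
      simp
    have h2 : ∀ y, pairLoc₁ v ω χ ℓ u x y = 0 := fun y => by
      unfold pairLoc₁
      rw [h0]
      simp
    simp only [h1, h2, lintegral_zero]

end Unperiodisation

/-! ### Step 3a: the partition of `(A ∪ B)^ι` according to which coordinates lie in `A` -/

/-- The cell of the partition of `(A ∪ B)^ι` indexed by `S ⊆ ι`: the coordinates in `S` lie in
`A`, the others in `B` (local notation). -/
local notation "piSel[" S ", " A ", " B "]" =>
  Set.pi Set.univ (fun i => ite (i ∈ S) A B)

section Partition

variable {ι : Type*} [DecidableEq ι] {β : Type*}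

/-- Membership in a cell of the partition. [folklore] -/
theorem mem_piSel {S : Finset ι} {A B : Set β} {X : ι → β} :
    X ∈ piSel[S, A, B] ↔ ∀ i, (i ∈ S → X i ∈ A) ∧ (i ∉ S → X i ∈ B) := by
  simp only [Set.mem_univ_pi]
  refine forall_congr' fun i => ?_
  by_cases h : i ∈ S <;> simp [h]

/-- The cells are measurable. [folklore] -/
theorem measurableSet_piSel [Countable ι] [MeasurableSpace β] (S : Finset ι) {A B : Set β}
    (hA : MeasurableSet A) (hB : MeasurableSet B) : MeasurableSet (piSel[S, A, B] : Set (ι → β)) :=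
  MeasurableSet.univ_pi fun i => by by_cases h : i ∈ S <;> simp [h, hA, hB]

/-- A point of `(A ∪ B)^ι` (`A`, `B` disjoint) lies in exactly one cell: the one indexed by the
set `S₀` of its coordinates in `A`. [folklore] -/
theorem mem_piSel_iff_eq {A B : Set β} (hAB : Disjoint A B) {X : ι → β} (hX : ∀ i, X i ∈ A ∪ B)
    (S S₀ : Finset ι) (hS₀ : ∀ i, i ∈ S₀ ↔ X i ∈ A) : X ∈ piSel[S, A, B] ↔ S = S₀ := by
  rw [mem_piSel]
  constructor
  · intro h
    ext i
    rw [hS₀]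
    refine ⟨fun hi => (h i).1 hi, fun hi => ?_⟩
    by_contra hiS
    exact Set.disjoint_left.1 hAB hi ((h i).2 hiS)
  · rintro rfl i
    refine ⟨fun hi => (hS₀ i).1 hi, fun hi => ?_⟩
    rcases hX i with h | h
    · exact absurd ((hS₀ i).2 h) hi
    · exact h

/-- A point of a cell lies in `(A ∪ B)^ι`. [folklore] -/
theorem mem_union_of_mem_piSel {S : Finset ι} {A B : Set β} {X : ι → β} (h : X ∈ piSel[S, A, B])
    (i : ι) : X i ∈ A ∪ B := by
  rw [mem_piSel] at h
  by_cases hi : i ∈ S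
  · exact Or.inl ((h i).1 hi)
  · exact Or.inr ((h i).2 hi)

variable [Fintype ι]

/-- **Partition of unity**: `1_{(A ∪ B)^ι} = ∑_S 1_{A^S × B^{Sᶜ}}`. [folklore] -/
theorem sum_indicator_piSel {A B : Set β} (hAB : Disjoint A B) (f : (ι → β) → ℝ≥0∞) (X : ι → β) :
    ∑ S : Finset ι, (piSel[S, A, B]).indicator f X = (Set.univ.pi fun _ => A ∪ B).indicator f X := by
  classical
  by_cases hX : ∀ i, X i ∈ A ∪ B
  · set S₀ : Finset ι := Finset.univ.filter fun i => X i ∈ A with hS₀def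
    have hS₀ : ∀ i, i ∈ S₀ ↔ X i ∈ A := fun i => by simp [hS₀def]
    have hmem : X ∈ Set.univ.pi fun _ : ι => A ∪ B := fun i _ => hX i
    rw [Set.indicator_of_mem hmem]
    have key : ∀ S : Finset ι, (piSel[S, A, B]).indicator f X = if S = S₀ then f X else 0 := by
      intro S
      by_cases h : S = S₀
      · rw [if_pos h, Set.indicator_of_mem ((mem_piSel_iff_eq hAB hX S S₀ hS₀).2 h)]
      · rw [if_neg h, Set.indicator_of_notMem (mt (mem_piSel_iff_eq hAB hX S S₀ hS₀).1 h)]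
    simp only [key, Finset.sum_ite_eq', Finset.mem_univ, if_true]
  · have hnot : X ∉ Set.univ.pi fun _ : ι => A ∪ B := fun h => hX fun i => h i (Set.mem_univ _)
    rw [Set.indicator_of_notMem hnot]
    exact Finset.sum_eq_zero fun S _ =>
      Set.indicator_of_notMem (fun h => hX (mem_union_of_mem_piSel h)) _

/-- **Weighted partition of unity**: `∑_{S ∋ i} 1_{A^S × B^{Sᶜ}}(X) = 1_{(A ∪ B)^ι}(X) 1_A(xᵢ)`.
[folklore] -/
theorem sum_indicator_piSel_mem {A B : Set β} (hAB : Disjoint A B) (f : (ι → β) → ℝ≥0∞) (i : ι)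
    (X : ι → β) :
    ∑ S : Finset ι, (if i ∈ S then (piSel[S, A, B]).indicator f X else 0) =
      (Set.univ.pi fun _ => A ∪ B).indicator (fun X => A.indicator 1 (X i) * f X) X := by
  classical
  by_cases hX : ∀ i, X i ∈ A ∪ B
  · set S₀ : Finset ι := Finset.univ.filter fun i => X i ∈ A with hS₀def
    have hS₀ : ∀ i, i ∈ S₀ ↔ X i ∈ A := fun i => by simp [hS₀def]
    have hmem : X ∈ Set.univ.pi fun _ : ι => A ∪ B := fun i _ => hX i
    rw [Set.indicator_of_mem hmem]
    have key : ∀ S : Finset ι, (if i ∈ S then (piSel[S, A, B]).indicator f X else 0) =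
        if S = S₀ then (if i ∈ S₀ then f X else 0) else 0 := by
      intro S
      by_cases h : S = S₀
      · subst h
        rw [if_pos rfl, Set.indicator_of_mem ((mem_piSel_iff_eq hAB hX _ _ hS₀).2 rfl)]
      · rw [if_neg h, Set.indicator_of_notMem (mt (mem_piSel_iff_eq hAB hX S S₀ hS₀).1 h),
          ite_self]
    simp only [key, Finset.sum_ite_eq', Finset.mem_univ, if_true]
    by_cases hi : X i ∈ A
    · rw [if_pos ((hS₀ i).2 hi), Set.indicator_of_mem hi, Pi.one_apply, one_mul]
    · rw [if_neg (mt (hS₀ i).1 hi), Set.indicator_of_notMem hi, zero_mul]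
  · have hnot : X ∉ Set.univ.pi fun _ : ι => A ∪ B := fun h => hX fun i => h i (Set.mem_univ _)
    rw [Set.indicator_of_notMem hnot]
    refine Finset.sum_eq_zero fun S _ => ?_
    rw [Set.indicator_of_notMem (fun h => hX (mem_union_of_mem_piSel h)), ite_self]

variable [MeasurableSpace β]

/-- **Decomposition of the integral over `(A ∪ B)^ι`** along the partition. [folklore] -/
theorem lintegral_pi_union_eq_sum (μ : Measure (ι → β)) {A B : Set β} (hA : MeasurableSet A)
    (hB : MeasurableSet B) (hAB : Disjoint A B) {f : (ι → β) → ℝ≥0∞} (hf : Measurable f) :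
    ∫⁻ X in Set.univ.pi fun _ => A ∪ B, f X ∂μ = ∑ S : Finset ι, ∫⁻ X in piSel[S, A, B], f X ∂μ := by
  rw [← lintegral_indicator (MeasurableSet.univ_pi fun _ => hA.union hB)]
  have h1 : ∀ S : Finset ι, ∫⁻ X in piSel[S, A, B], f X ∂μ = ∫⁻ X, (piSel[S, A, B]).indicator f X ∂μ :=
    fun S => (lintegral_indicator (measurableSet_piSel S hA hB) f).symm
  simp only [h1]
  rw [← lintegral_finsetSum _ fun S _ => hf.indicator (measurableSet_piSel S hA hB)]
  exact lintegral_congr fun X => (sum_indicator_piSel hAB f X).symm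

/-- **Decomposition of `∫_{(A ∪ B)^ι} 1_A(xᵢ) f`** along the partition: only the cells with
`i ∈ S` see it. [folklore] -/
theorem lintegral_pi_union_indicator_eq_sum (μ : Measure (ι → β)) {A B : Set β}
    (hA : MeasurableSet A) (hB : MeasurableSet B) (hAB : Disjoint A B) {f : (ι → β) → ℝ≥0∞}
    (hf : Measurable f) (i : ι) :
    ∫⁻ X in Set.univ.pi fun _ => A ∪ B, A.indicator 1 (X i) * f X ∂μ =
      ∑ S : Finset ι, if i ∈ S then ∫⁻ X in piSel[S, A, B], f X ∂μ else 0 := by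
  rw [← lintegral_indicator (MeasurableSet.univ_pi fun _ => hA.union hB)]
  have h1 : ∀ S : Finset ι, (if i ∈ S then ∫⁻ X in piSel[S, A, B], f X ∂μ else 0) =
      ∫⁻ X, (if i ∈ S then (piSel[S, A, B]).indicator f X else 0) ∂μ := by
    intro S
    by_cases h : i ∈ S
    · simp only [if_pos h, lintegral_indicator (measurableSet_piSel S hA hB)]
    · simp only [if_neg h, lintegral_zero]
  simp only [h1]
  rw [← lintegral_finsetSum _ fun S _ => ?_]
  · exact lintegral_congr fun X => (sum_indicator_piSel_mem hAB f i X).symm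
  · by_cases h : i ∈ S
    · simp only [if_pos h]; exact hf.indicator (measurableSet_piSel S hA hB)
    · simp only [if_neg h]; exact measurable_const

end Partition

/-! ### Step 3b: splitting the configuration, `Ω^N ≃ Ω^{|S|} × Ω^{Sᶜ}` -/

/-- The increasing enumeration `Fin |S| ≃o S` (local notation). -/
local notation "eS[" S "]" => Finset.orderIsoOfFin S rfl

/-- The measurable equivalence `(ℝ³)^N ≃ (ℝ³)^{|S|} × (ℝ³)^{Sᶜ}`, `X ↦ ((X_{e_S(j)})_j, X|_{Sᶜ})`
(local notation). -/
local notation "split[" S "]" =>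
  MeasurableEquiv.trans
    (MeasurableEquiv.piEquivPiSubtypeProd (fun _ : Fin _ => Space) (fun i => i ∈ S))
    (MeasurableEquiv.prodCongr
      (MeasurableEquiv.symm
        (MeasurableEquiv.piCongrLeft (fun _ : {i // i ∈ S} => Space)
          (RelIso.toEquiv (Finset.orderIsoOfFin S rfl))))
      (MeasurableEquiv.refl ({i // i ∉ S} → Space)))

section Split

variable {N : ℕ}

/-- First component of the splitting: the `S`-coordinates, enumerated increasingly. [folklore] -/
theorem split_apply_fst (S : Finset (Fin N)) (X : Config N) (j : Fin S.card) :
    (split[S] X).1 j = X (eS[S] j) := rfl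

/-- Second component of the splitting: the `Sᶜ`-coordinates. [folklore] -/
theorem split_apply_snd (S : Finset (Fin N)) (X : Config N) (i : {i // i ∉ S}) :
    (split[S] X).2 i = X i := rfl

/-- The inverse splitting on an `S`-coordinate. [folklore] -/
theorem split_symm_apply_of_mem (S : Finset (Fin N)) (Z : Config S.card) (Y : {i // i ∉ S} → Space)
    {i : Fin N} (hi : i ∈ S) : (split[S]).symm (Z, Y) i = Z ((eS[S]).symm ⟨i, hi⟩) := by
  have h := congr_fun (congr_arg Prod.fst ((split[S]).apply_symm_apply (Z, Y))) ((eS[S]).symm ⟨i, hi⟩)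
  rw [split_apply_fst, OrderIso.apply_symm_apply] at h
  exact h

/-- The inverse splitting on an `Sᶜ`-coordinate. [folklore] -/
theorem split_symm_apply_of_not_mem (S : Finset (Fin N)) (Z : Config S.card)
    (Y : {i // i ∉ S} → Space) {i : Fin N} (hi : i ∉ S) : (split[S]).symm (Z, Y) i = Y ⟨i, hi⟩ := by
  have h := congr_fun (congr_arg Prod.snd ((split[S]).apply_symm_apply (Z, Y))) ⟨i, hi⟩
  rw [split_apply_snd] at h
  exact h

/-- The inverse splitting at an enumerated coordinate. [folklore] -/
theorem split_symm_apply_coe (S : Finset (Fin N)) (Z : Config S.card) (Y : {i // i ∉ S} → Space)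
    (j : Fin S.card) : (split[S]).symm (Z, Y) (eS[S] j) = Z j := by
  rw [split_symm_apply_of_mem S Z Y (eS[S] j).2]
  congr 1
  exact (eS[S]).symm_apply_apply j

/-- The splitting preserves Lebesgue measure. [folklore] -/
theorem measurePreserving_split (S : Finset (Fin N)) :
    MeasurePreserving (split[S]) volume (volume.prod volume) := by
  -- the `Fintype ↥S` instance used inside `volume_preserving_piEquivPiSubtypeProd` (`Subtype.fintype`)
  -- differs from the one instance search finds (`Finset.Subtype.fintype`); fix it locally
  letI : Fintype {i // i ∈ S} := Subtype.fintype _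
  have h1 : MeasurePreserving
      (MeasurableEquiv.piEquivPiSubtypeProd (fun _ : Fin N => Space) (fun i => i ∈ S)) volume
      ((volume : Measure ({i // i ∈ S} → Space)).prod (volume : Measure ({i // i ∉ S} → Space))) :=
    volume_preserving_piEquivPiSubtypeProd (fun _ : Fin N => Space) (fun i => i ∈ S)
  have hπ := ((volume_measurePreserving_piCongrLeft (fun _ : {i // i ∈ S} => Space)
      (RelIso.toEquiv (eS[S]))).symm).prod
    (MeasurePreserving.id (volume : Measure ({i // i ∉ S} → Space)))
  have h2 : MeasurePreserving
      (MeasurableEquiv.prodCongr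
        (MeasurableEquiv.symm
          (MeasurableEquiv.piCongrLeft (fun _ : {i // i ∈ S} => Space) (RelIso.toEquiv (eS[S]))))
        (MeasurableEquiv.refl ({i // i ∉ S} → Space)))
      (volume.prod volume) (volume.prod volume) :=
    ⟨MeasurableEquiv.measurable _, hπ.map_eq⟩
  exact h1.trans h2

/-- Under the splitting, the cell `A^S × B^{Sᶜ}` of the partition is a product set. [folklore] -/
theorem split_symm_preimage_piSel (S : Finset (Fin N)) (A B : Set Space) :
    (split[S]).symm ⁻¹' (piSel[S, A, B] : Set (Config N)) =
      (Set.univ.pi fun _ : Fin S.card => A) ×ˢ (Set.univ.pi fun _ : {i // i ∉ S} => B) := by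
  ext ⟨Z, Y⟩
  rw [Set.mem_preimage, mem_piSel]
  simp only [Set.mem_prod, Set.mem_univ_pi]
  constructor
  · intro h
    refine ⟨fun j => ?_, fun i => ?_⟩
    · have := (h (eS[S] j)).1 (eS[S] j).2
      rwa [split_symm_apply_coe] at this
    · have := (h i).2 i.2
      rwa [split_symm_apply_of_not_mem S Z Y i.2] at this
  · rintro ⟨hZ, hY⟩ i
    refine ⟨fun hi => ?_, fun hi => ?_⟩
    · rw [split_symm_apply_of_mem S Z Y hi]; exact hZ _
    · rw [split_symm_apply_of_not_mem S Z Y hi]; exact hY ⟨i, hi⟩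

/-- **Tonelli on a cell of the partition**: `∫_{A^S × B^{Sᶜ}} F = ∫_{B^{Sᶜ}} ∫_{A^{|S|}} F(Z ⊔ Y) dZ dY`.
[folklore] -/
theorem lintegral_piSel_eq (S : Finset (Fin N)) (A B : Set Space) {F : Config N → ℝ≥0∞}
    (hF : Measurable F) :
    ∫⁻ X in piSel[S, A, B], F X =
      ∫⁻ Y in Set.univ.pi fun _ : {i // i ∉ S} => B,
        ∫⁻ Z in Set.univ.pi fun _ : Fin S.card => A, F ((split[S]).symm (Z, Y)) := by
  have hmp := (measurePreserving_split S).symm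
  rw [← hmp.setLIntegral_comp_preimage_emb (split[S]).symm.measurableEmbedding F _,
    split_symm_preimage_piSel,
    setLIntegral_prod_symm (fun q => F ((split[S]).symm q))
      (hF.comp (split[S]).symm.measurable).aemeasurable]

/-- Updating an enumerated coordinate commutes with the splitting. [folklore] -/
theorem split_symm_update (S : Finset (Fin N)) (Z : Config S.card) (Y : {i // i ∉ S} → Space)
    (j : Fin S.card) (x : Space) :
    (split[S]).symm (Function.update Z j x, Y) =
      Function.update ((split[S]).symm (Z, Y)) (eS[S] j) x := by
  funext i
  by_cases hi : i ∈ S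
  · rw [split_symm_apply_of_mem S _ Y hi]
    by_cases hij : i = eS[S] j
    · subst hij
      rw [Function.update_self]
      have : (eS[S]).symm ⟨(eS[S] j : Fin N), hi⟩ = j := (eS[S]).symm_apply_apply j
      rw [this, Function.update_self]
    · rw [Function.update_of_ne hij, split_symm_apply_of_mem S Z Y hi, Function.update_of_ne]
      intro hj
      apply hij
      rw [← hj, OrderIso.apply_symm_apply]
  · have hij : i ≠ eS[S] j := fun h => hi (h ▸ (eS[S] j).2)
    rw [Function.update_of_ne hij, split_symm_apply_of_not_mem S _ Y hi,
      split_symm_apply_of_not_mem S Z Y hi]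

/-- Permuting the enumerated coordinates is a permutation of all coordinates (fixing `Sᶜ`).
[folklore] -/
theorem exists_split_symm_comp_perm (S : Finset (Fin N)) (Z : Config S.card)
    (Y : {i // i ∉ S} → Space) (σ : Equiv.Perm (Fin S.card)) :
    ∃ τ : Equiv.Perm (Fin N), (split[S]).symm (Z ∘ σ, Y) = (split[S]).symm (Z, Y) ∘ τ := by
  let π : Equiv.Perm {i // i ∈ S} :=
    { toFun := fun x => eS[S] (σ ((eS[S]).symm x))
      invFun := fun x => eS[S] (σ.symm ((eS[S]).symm x))
      left_inv := fun x => by simp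
      right_inv := fun x => by simp }
  refine ⟨Equiv.Perm.ofSubtype π, funext fun i => ?_⟩
  by_cases hi : i ∈ S
  · rw [split_symm_apply_of_mem S _ Y hi, Function.comp_apply, Function.comp_apply,
      Equiv.Perm.ofSubtype_apply_of_mem π hi]
    change Z (σ ((eS[S]).symm ⟨i, hi⟩)) = (split[S]).symm (Z, Y) (eS[S] (σ ((eS[S]).symm ⟨i, hi⟩)))
    rw [split_symm_apply_coe]
  · rw [split_symm_apply_of_not_mem S _ Y hi, Function.comp_apply,
      Equiv.Perm.ofSubtype_apply_of_not_mem π hi, split_symm_apply_of_not_mem S Z Y hi]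

end Split

/-! ### Step 3c: the slice forms do not see the sliced coordinate (kinetic bookkeeping) -/

section Counting

/-- **Exchange of weights on an ignored coordinate.** If `F ≥ 0` on a finite product does not
depend on the `i`-th coordinate, then `(∫ g₂) ∫ g₁(xᵢ) F(X) dX = (∫ g₁) ∫ g₂(xᵢ) F(X) dX` for the
product measure. (With `g₂ = 1`, `g₁ = 1_Λ`: `|B| ∫_{B^N ∩ {xᵢ ∈ Λ}} F = |Λ| ∫_{B^N} F`.) [folklore] -/
theorem lintegral_mul_comp_apply_swap {ι : Type*} [Fintype ι] [DecidableEq ι] {α : ι → Type*}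
    [∀ i, MeasurableSpace (α i)] (μ : ∀ i, Measure (α i)) [∀ i, SigmaFinite (μ i)] (i : ι)
    {F : (∀ i, α i) → ℝ≥0∞} (hF : Measurable F) (hFi : ∀ X x, F (Function.update X i x) = F X)
    {g₁ g₂ : α i → ℝ≥0∞} (hg₁ : Measurable g₁) (hg₂ : Measurable g₂) :
    (∫⁻ x, g₂ x ∂μ i) * ∫⁻ X, g₁ (X i) * F X ∂Measure.pi μ =
      (∫⁻ x, g₁ x ∂μ i) * ∫⁻ X, g₂ (X i) * F X ∂Measure.pi μ := by
  have hm₁ : Measurable fun X : ∀ i, α i => g₁ (X i) * F X := (hg₁.comp (measurable_pi_apply i)).mul hF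
  have hm₂ : Measurable fun X : ∀ i, α i => g₂ (X i) * F X := (hg₂.comp (measurable_pi_apply i)).mul hF
  rw [← lintegral_const_mul _ hm₁, ← lintegral_const_mul _ hm₂]
  refine lintegral_eq_of_lmarginal_eq {i} (measurable_const.mul hm₁) (measurable_const.mul hm₂) ?_
  funext X
  simp only [lmarginal_singleton, Function.update_self, hFi]
  rw [lintegral_const_mul _ (hg₁.mul_const _), lintegral_mul_const _ hg₁,
    lintegral_const_mul _ (hg₂.mul_const _), lintegral_mul_const _ hg₂]
  ring

end Counting

/-! ### Step 3d: the box forms of `Φ_{S,Y} = Ψ(· ⊔ Y)` are those of `Ψ` seen from the cell `S` -/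

section Identification

variable {N : ℕ} {χ : Space → ℝ} {ℓ : ℝ} {v : ℝ → ℝ≥0∞} {ω : Space → ℝ}

/-- Off the box `Λ(u)` (in the second variable) the localised pair potential vanishes.
[cite: Fournais2020, (2.8)] -/
theorem pairLoc_eq_zero_of_not_mem_right (hχ : IsLocalizationFunction χ) (hℓ : 0 < ℓ) {u y : Space}
    (x : Space) (hy : y ∉ slidingBox ℓ u) : pairLoc v χ ℓ u x y = 0 := by
  simp [pairLoc, locFun_eq_zero_of_not_mem hχ hℓ hy]

/-- `X ↦ ρ_μ ∑ᵢ ∫ w₁(xᵢ, y) dy` is measurable. [cite: Fournais2020, (2.6)] -/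
theorem measurable_attrBoxN {M : ℕ} (hvm : Measurable v) (hω : Measurable ω)
    (hχ : IsLocalizationFunction χ) (ℓ ρμ : ℝ) (u : Space) :
    Measurable fun X : Config M => attrBoxN v ω χ ℓ ρμ u X := by
  have hterm : ∀ i : Fin M, Measurable fun X : Config M => ∫⁻ y, pairLoc₁ v ω χ ℓ u (X i) y := by
    intro i
    have hi : Measurable fun q : Config M × Space => q.1 i := (measurable_pi_apply i).comp measurable_fst
    -- (`have := …; exact this`: elaborating `.comp` against the expected type makes `whnf` diverge)
    have h := (measurable_pairLoc₁₂ hvm hω hχ ℓ u).comp (hi.prodMk measurable_snd)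
    have h' : Measurable fun q : Config M × Space => pairLoc₁ v ω χ ℓ u (q.1 i) q.2 := h
    exact h'.lintegral_prod_right'
  unfold attrBoxN
  exact (Finset.measurable_sum _ fun i _ => hterm i).const_mul _

/-- `X ↦ ∑_{i<j} w(xᵢ, xⱼ)` is measurable. [cite: Fournais2020, (2.6)] -/
theorem measurable_repBoxN {M : ℕ} (hvm : Measurable v) (hχ : IsLocalizationFunction χ) (ℓ : ℝ)
    (u : Space) : Measurable fun X : Config M => repBoxN v χ ℓ u X := by
  have hij : ∀ i j : Fin M, Measurable fun X : Config M => pairLoc v χ ℓ u (X i) (X j) := by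
    intro i j
    have hi : Measurable fun X : Config M => X i := measurable_pi_apply i
    have hj : Measurable fun X : Config M => X j := measurable_pi_apply j
    have h := (measurable_pairLoc₂ hvm hχ ℓ u).comp (hi.prodMk hj)
    exact h
  unfold repBoxN
  exact Finset.measurable_sum _ fun i _ => Finset.measurable_sum _ fun j _ => hij i j

/-- **Re-enumeration**: a sum over all particles of a quantity vanishing off `S` is the sum over
the enumeration of `S`. [folklore] -/
theorem sum_eq_sum_enum (S : Finset (Fin N)) {G : Fin N → ℝ≥0∞} (hG : ∀ i ∉ S, G i = 0) :
    ∑ i, G i = ∑ j : Fin S.card, G (eS[S] j) := by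
  rw [← Finset.sum_subset (Finset.subset_univ S) fun i _ hi => hG i hi, ← Finset.sum_coe_sort]
  exact (Fintype.sum_equiv (RelIso.toEquiv (eS[S])) (fun j => G (eS[S] j)) (fun i => G i)
    fun j => rfl).symm

variable {S : Finset (Fin N)} {u : Space}

/-- One-body sums of `Ψ(Z ⊔ Y)` with `Y` off the box: only the `S`-particles contribute.
[cite: Fournais2020, (3.16)] -/
theorem sum_split_symm (Z : Config S.card) {Y : {i // i ∉ S} → Space} (hY : ∀ i, Y i ∉ slidingBox ℓ u)
    {φ : Space → ℝ≥0∞} (hφ : ∀ x ∉ slidingBox ℓ u, φ x = 0) :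
    ∑ i : Fin N, φ ((split[S]).symm (Z, Y) i) = ∑ j : Fin S.card, φ (Z j) := by
  rw [sum_eq_sum_enum S fun i hi => by rw [split_symm_apply_of_not_mem S Z Y hi]; exact hφ _ (hY _)]
  simp only [split_symm_apply_coe]

/-- **The attraction of `Φ_{S,Y}` is that of `Ψ`**: `ρ_μ∑_{i≤N}∫w₁(xᵢ,y)dy` at `Z ⊔ Y` (with `Y` off
the box) equals `ρ_μ∑_{j≤|S|}∫w₁(zⱼ,y)dy`. [cite: Fournais2020, (3.16)] -/
theorem attrBoxN_split_symm (hχ : IsLocalizationFunction χ) (hℓ : 0 < ℓ) (ρμ : ℝ) (Z : Config S.card)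
    {Y : {i // i ∉ S} → Space} (hY : ∀ i, Y i ∉ slidingBox ℓ u) :
    attrBoxN v ω χ ℓ ρμ u ((split[S]).symm (Z, Y)) = attrBoxN v ω χ ℓ ρμ u Z := by
  unfold attrBoxN
  congr 1
  exact sum_split_symm Z hY (φ := fun x => ∫⁻ y, pairLoc₁ v ω χ ℓ u x y) fun x hx => by
    simp only [pairLoc₁_eq_zero_of_not_mem hχ hℓ hx, lintegral_zero]

/-- **The repulsion of `Φ_{S,Y}` is that of `Ψ`**: `∑_{i<i'} w(xᵢ,x_{i'})` at `Z ⊔ Y` equals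
`∑_{j<j'} w(zⱼ,z_{j'})` (the enumeration of `S` is increasing). [cite: Fournais2020, (3.16)] -/
theorem repBoxN_split_symm (hχ : IsLocalizationFunction χ) (hℓ : 0 < ℓ) (Z : Config S.card)
    {Y : {i // i ∉ S} → Space} (hY : ∀ i, Y i ∉ slidingBox ℓ u) :
    repBoxN v χ ℓ u ((split[S]).symm (Z, Y)) = repBoxN v χ ℓ u Z := by
  unfold repBoxN
  simp only [Finset.sum_filter]
  rw [sum_eq_sum_enum S fun i hi => Finset.sum_eq_zero fun i' _ => by
    rw [split_symm_apply_of_not_mem S Z Y hi, pairLoc_eq_zero_of_not_mem hχ hℓ (hY _), ite_self]]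
  refine Finset.sum_congr rfl fun j _ => ?_
  rw [sum_eq_sum_enum S fun i' hi' => by
    rw [split_symm_apply_of_not_mem S Z Y hi', pairLoc_eq_zero_of_not_mem_right hχ hℓ _ (hY _),
      ite_self]]
  refine Finset.sum_congr rfl fun j' _ => ?_
  rw [split_symm_apply_coe, split_symm_apply_coe]
  by_cases h : j < j'
  · rw [if_pos h, if_pos (Subtype.coe_lt_coe.2 ((eS[S]).lt_iff_lt.2 h))]
  · rw [if_neg h, if_neg fun h' => h ((eS[S]).lt_iff_lt.1 (Subtype.coe_lt_coe.1 h'))]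

/-- **The kinetic form of `Φ_{S,Y}` in terms of the slices of `Ψ`**: the `j`-th slice of
`Φ_{S,Y} = Ψ(· ⊔ Y)` through `Z` is the `e_S(j)`-th slice of `Ψ` through `Z ⊔ Y`.
[cite: Fournais2020, (3.16)] -/
theorem kinBoxN_split_symm (χ : Space → ℝ) (ℓ s b : ℝ) (u : Space) (S : Finset (Fin N))
    (Ψ : Config N → ℂ) (Y : {i // i ∉ S} → Space) :
    kinBoxN χ ℓ s b u (fun Z => Ψ ((split[S]).symm (Z, Y))) =
      ∑ j : Fin S.card, (ENNReal.ofReal ℓ ^ 3)⁻¹ * ∫⁻ Z in boxConfig S.card ℓ u,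
        kinLoc χ ℓ s b u fun x => Ψ (Function.update ((split[S]).symm (Z, Y)) (eS[S] j) x) := by
  unfold kinBoxN
  simp only [split_symm_update]

/-- `Φ_{S,Y} = Ψ(· ⊔ Y)` is measurable for continuous `Ψ`. [folklore] -/
theorem measurable_split_symm_left (S : Finset (Fin N)) {Ψ : Config N → ℂ} (hΨ : Measurable Ψ)
    (Y : {i // i ∉ S} → Space) : Measurable fun Z : Config S.card => Ψ ((split[S]).symm (Z, Y)) :=
  hΨ.comp ((split[S]).symm.measurable.comp (measurable_id.prodMk measurable_const))

/-- `Φ_{S,Y} = Ψ(· ⊔ Y)` is symmetric for symmetric `Ψ`. [cite: Fournais2020, (3.16)] -/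
theorem symm_split_symm_left (S : Finset (Fin N)) {Ψ : Config N → ℂ}
    (hΨ : ∀ (σ : Equiv.Perm (Fin N)) (X : Config N), Ψ (X ∘ σ) = Ψ X) (Y : {i // i ∉ S} → Space)
    (σ : Equiv.Perm (Fin S.card)) (Z : Config S.card) :
    Ψ ((split[S]).symm (Z ∘ σ, Y)) = Ψ ((split[S]).symm (Z, Y)) := by
  obtain ⟨τ, hτ⟩ := exists_split_symm_comp_perm S Z Y σ
  rw [hτ, hΨ]

/-- `Λ(u)^M` is a product set. [cite: Fournais2020, (2.6)] -/
theorem boxConfig_eq_pi (M : ℕ) (ℓ : ℝ) (u : Space) :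
    boxConfig M ℓ u = Set.univ.pi fun _ : Fin M => slidingBox ℓ u := by
  ext Z; simp [boxConfig]

end Identification

/-! ### Step 1 bis: the shifted cell `Ω' = u - (L/2)𝟙 + [0,L)³ ⊇ Λ(u)` -/

set_option quotPrecheck false in
/-- The shifted cell `Ω'(u) = {x | x_k - u_k ∈ [-L/2, L/2)}` (local notation). -/
local notation "cellAt[" L ", " u "]" =>
  {x : Space | ∀ k : Fin 3, x k - u k ∈ Set.Ico (-(L / 2)) (L / 2)}

section ShiftedCell

variable {N : ℕ} {L ℓ : ℝ}

/-- The shifted cell is measurable. [folklore] -/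
theorem measurableSet_cellAt (L : ℝ) (u : Space) : MeasurableSet (cellAt[L, u]) := by
  have : (cellAt[L, u]) = ⋂ k : Fin 3, (fun x : Space => x k - u k) ⁻¹' Set.Ico (-(L / 2)) (L / 2) := by
    ext x; simp
  rw [this]
  exact MeasurableSet.iInter fun k => measurableSet_Ico.preimage (by fun_prop)

/-- `|Ω'(u)| = L³`. [folklore] -/
theorem volume_cellAt (L : ℝ) (u : Space) : volume (cellAt[L, u]) = ENNReal.ofReal L ^ 3 := by
  have h : (cellAt[L, u]) = (@ofLp 2 (Fin 3 → ℝ)) ⁻¹'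
      (Set.univ.pi fun k => Set.Ico (u k + -(L / 2)) (u k + L / 2)) := by
    ext x
    simp only [Set.mem_Ico, Set.mem_setOf_eq, Set.mem_preimage, Set.mem_pi, Set.mem_univ,
      forall_const]
    refine forall_congr' fun k => ?_
    constructor <;> rintro ⟨h1, h2⟩ <;> constructor <;> linarith
  rw [h, (PiLp.volume_preserving_ofLp (Fin 3)).measure_preimage
    (MeasurableSet.univ_pi fun _ => measurableSet_Ico).nullMeasurableSet, volume_pi_pi]
  have hk : ∀ k, u.ofLp k + L / 2 - (u.ofLp k + -(L / 2)) = L := fun k => by ring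
  simp only [Real.volume_Ico, hk, Finset.prod_const, Finset.card_univ, Fintype.card_fin]

/-- `Λ(u) ⊆ Ω'(u)` for `ℓ < L`. [cite: Fournais2020, (3.4)] -/
theorem slidingBox_subset_cellAt (hℓL : ℓ < L) (u : Space) : slidingBox ℓ u ⊆ cellAt[L, u] := by
  intro x hx k
  have h := hx k
  rw [Set.mem_Icc] at h
  rw [Set.mem_Ico]
  constructor <;> linarith

/-- Points of `Ω'(u)` are within `L/2` of `u` in every coordinate. [folklore] -/
theorem abs_sub_le_of_mem_cellAt {u x : Space} (hx : x ∈ cellAt[L, u]) (k : Fin 3) :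
    |x k - u k| ≤ L / 2 := by
  have h := hx k
  rw [Set.mem_Ico] at h
  rw [abs_le]
  constructor <;> linarith

/-- `Ω'(u)^N` is the translate of `[0,L)^{3N}` by `u - (L/2)𝟙` in every particle. [folklore] -/
theorem pi_cellAt_eq_image (N : ℕ) (L : ℝ) (u : Space) :
    (Set.univ.pi fun _ : Fin N => cellAt[L, u]) =
      (fun X : Config N => X + fun _ => u - toLp 2 fun _ : Fin 3 => L / 2) '' cellN N L := by
  ext X
  simp only [Set.mem_univ_pi, Set.mem_image]
  constructor
  · intro h
    refine ⟨X - fun _ => u - toLp 2 fun _ : Fin 3 => L / 2, fun i k => ?_, by abel⟩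
    have := h i k
    simp only [Set.mem_Ico] at this
    simp only [Pi.sub_apply, PiLp.sub_apply, Set.mem_Ico]
    constructor <;> linarith [this.1, this.2]
  · rintro ⟨X', hX', rfl⟩ i k
    have := hX' i k
    simp only [Set.mem_Ico] at this
    simp only [Pi.add_apply, PiLp.add_apply, PiLp.sub_apply, Set.mem_Ico]
    constructor <;> linarith [this.1, this.2]

/-- **Shift of the cell**: for `G ≥ 0` periodic in every particle and axis,
`∫_{Ω'(u)^N} G = ∫_{[0,L)^{3N}} G`. [folklore] -/
theorem lintegral_pi_cellAt (hL : 0 < L) (u : Space) {G : Config N → ℝ≥0∞}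
    (hG : ∀ (X : Config N) (i : Fin N) (k : Fin 3),
      G (X + Pi.single i (EuclideanSpace.single k L)) = G X) :
    ∫⁻ X in Set.univ.pi fun _ : Fin N => cellAt[L, u], G X = ∫⁻ X in cellN N L, G X := by
  rw [pi_cellAt_eq_image,
    ← (measurePreserving_add_right volume _).setLIntegral_comp_emb (measurableEmbedding_addRight _)]
  exact lintegral_cellN_comp_add hL hG _

/-- Lebesgue measure restricted to `Ω'(u)^N` is a product of restricted measures. [folklore] -/
theorem volume_restrict_pi_cellAt (N : ℕ) (L : ℝ) (u : Space) :
    (volume : Measure (Config N)).restrict (Set.univ.pi fun _ : Fin N => cellAt[L, u]) =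
      Measure.pi fun _ : Fin N => (volume : Measure Space).restrict (cellAt[L, u]) := by
  rw [volume_pi, Measure.restrict_pi_pi]

end ShiftedCell

/-! ### Step 3e: the global identities behind "the natural identifications" of (3.16) -/

section Chains

variable {N : ℕ} {L ℓ : ℝ}

/-- **Decomposition of `∫_{Ω'^N}` by the particles in `Λ(u)`**:
`∫_{Ω'^N} F = ∑_S ∫_{(Ω'∖Λ)^{Sᶜ}} ∫_{Λ^{|S|}} F(Z ⊔ Y) dZ dY`. [cite: Fournais2020, (3.16)] -/
theorem lintegral_pi_cellAt_eq_sum (hℓL : ℓ < L) (u : Space) {F : Config N → ℝ≥0∞}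
    (hF : Measurable F) :
    ∫⁻ X in Set.univ.pi fun _ : Fin N => cellAt[L, u], F X =
      ∑ S : Finset (Fin N),
        ∫⁻ Y in Set.univ.pi fun _ : {i // i ∉ S} => cellAt[L, u] \ slidingBox ℓ u,
          ∫⁻ Z in boxConfig S.card ℓ u, F ((split[S]).symm (Z, Y)) := by
  have hΛ := measurableSet_slidingBox ℓ u
  have hB := measurableSet_cellAt L u
  conv_lhs => rw [← Set.union_sdiff_cancel (slidingBox_subset_cellAt hℓL u)]
  rw [lintegral_pi_union_eq_sum _ hΛ (hB.diff hΛ) Set.disjoint_sdiff_right hF]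
  refine Finset.sum_congr rfl fun S _ => ?_
  rw [lintegral_piSel_eq S _ _ hF, boxConfig_eq_pi]

/-- **Decomposition of `∫_{Ω'^N ∩ {xᵢ ∈ Λ}}`**: only the cells with `i ∈ S` contribute.
[cite: Fournais2020, (3.16)] -/
theorem lintegral_pi_cellAt_indicator_eq_sum (hℓL : ℓ < L) (u : Space) {F : Config N → ℝ≥0∞}
    (hF : Measurable F) (i : Fin N) :
    ∫⁻ X in Set.univ.pi fun _ : Fin N => cellAt[L, u], (slidingBox ℓ u).indicator 1 (X i) * F X =
      ∑ S : Finset (Fin N), if i ∈ S then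
        ∫⁻ Y in Set.univ.pi fun _ : {i // i ∉ S} => cellAt[L, u] \ slidingBox ℓ u,
          ∫⁻ Z in boxConfig S.card ℓ u, F ((split[S]).symm (Z, Y)) else 0 := by
  have hΛ := measurableSet_slidingBox ℓ u
  have hB := measurableSet_cellAt L u
  conv_lhs => rw [← Set.union_sdiff_cancel (slidingBox_subset_cellAt hℓL u)]
  rw [lintegral_pi_union_indicator_eq_sum _ hΛ (hB.diff hΛ) Set.disjoint_sdiff_right hF]
  refine Finset.sum_congr rfl fun S _ => ?_
  by_cases h : i ∈ S
  · rw [if_pos h, if_pos h, lintegral_piSel_eq S _ _ hF, boxConfig_eq_pi]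
  · rw [if_neg h, if_neg h]

/-- **Kinetic bookkeeping**: a slice form does not depend on the sliced coordinate, so
`ℓ⁻³ ∫_{Ω'^N ∩ {xᵢ ∈ Λ}} K = L⁻³ ∫_{Ω'^N} K` (`|Λ| = ℓ³`, `|Ω'| = L³`). [cite: Fournais2020, (3.15)–(3.16)] -/
theorem kinetic_count (hℓ : 0 < ℓ) (hℓL : ℓ < L) (u : Space) (i : Fin N) {K : Config N → ℝ≥0∞}
    (hK : Measurable K) (hKi : ∀ X x, K (Function.update X i x) = K X) :
    (ENNReal.ofReal ℓ ^ 3)⁻¹ *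
        ∫⁻ X in Set.univ.pi fun _ : Fin N => cellAt[L, u], (slidingBox ℓ u).indicator 1 (X i) * K X =
      (ENNReal.ofReal L ^ 3)⁻¹ * ∫⁻ X in Set.univ.pi fun _ : Fin N => cellAt[L, u], K X := by
  have hL : 0 < L := hℓ.trans hℓL
  have hΛ := measurableSet_slidingBox ℓ u
  have h := lintegral_mul_comp_apply_swap (fun _ : Fin N => (volume : Measure Space).restrict (cellAt[L, u]))
    i hK hKi (g₁ := (slidingBox ℓ u).indicator 1) (g₂ := fun _ => 1)
    (measurable_const.indicator hΛ) measurable_const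
  rw [lintegral_const, Measure.restrict_apply_univ, volume_cellAt L u, lintegral_indicator_one hΛ,
    Measure.restrict_apply hΛ, Set.inter_eq_left.2 (slidingBox_subset_cellAt hℓL u),
    volume_slidingBox, ← volume_restrict_pi_cellAt] at h
  simp only [one_mul] at h
  -- `h : L³ · ∫ 1_Λ K = ℓ³ · ∫ K`
  have ha : ENNReal.ofReal L ^ 3 ≠ 0 := pow_ne_zero _ (by rw [Ne, ENNReal.ofReal_eq_zero, not_le]; exact hL)
  have ha' : ENNReal.ofReal L ^ 3 ≠ ⊤ := ENNReal.pow_ne_top ENNReal.ofReal_ne_top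
  have hb : ENNReal.ofReal ℓ ^ 3 ≠ 0 := pow_ne_zero _ (by rw [Ne, ENNReal.ofReal_eq_zero, not_le]; exact hℓ)
  have hb' : ENNReal.ofReal ℓ ^ 3 ≠ ⊤ := ENNReal.pow_ne_top ENNReal.ofReal_ne_top
  set P := ∫⁻ X in Set.univ.pi fun _ : Fin N => cellAt[L, u], (slidingBox ℓ u).indicator 1 (X i) * K X
  set Q := ∫⁻ X in Set.univ.pi fun _ : Fin N => cellAt[L, u], K X
  calc (ENNReal.ofReal ℓ ^ 3)⁻¹ * P
      = (ENNReal.ofReal ℓ ^ 3)⁻¹ * ((ENNReal.ofReal L ^ 3)⁻¹ * (ENNReal.ofReal L ^ 3 * P)) := by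
        rw [← mul_assoc (ENNReal.ofReal L ^ 3)⁻¹, ENNReal.inv_mul_cancel ha ha', one_mul]
    _ = (ENNReal.ofReal ℓ ^ 3)⁻¹ * ((ENNReal.ofReal L ^ 3)⁻¹ * (ENNReal.ofReal ℓ ^ 3 * Q)) := by rw [h]
    _ = (ENNReal.ofReal L ^ 3)⁻¹ * Q := by
        rw [← mul_assoc, mul_comm (ENNReal.ofReal ℓ ^ 3)⁻¹, mul_assoc, ← mul_assoc (ENNReal.ofReal ℓ ^ 3)⁻¹,
          ENNReal.inv_mul_cancel hb hb', one_mul]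

/-- **The kinetic terms of the sectors add up to `∑ᵢ⟨Ψ, T_u^{(i)}Ψ⟩`** (3.15):
`∑_S ∫_{(Ω'∖Λ)^{Sᶜ}} ∑_{j≤|S|} ⟨Φ_{S,Y}, T^{(j)} Φ_{S,Y}⟩ dY = ∑ᵢ L⁻³∫_{Ω^N} ⟨Ψ(X;·ᵢ), T_u Ψ(X;·ᵢ)⟩ dX`.
[cite: Fournais2020, (3.15)–(3.16)] -/
theorem sum_lintegral_kinBoxN_split (hℓ : 0 < ℓ) (h2ℓ : 2 * ℓ < L) {χ : Space → ℝ} (hχ : Continuous χ)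
    (s b : ℝ) (u : Space) (Ψ : PeriodicTrialState N L) :
    ∑ S : Finset (Fin N),
        ∫⁻ Y in Set.univ.pi fun _ : {i // i ∉ S} => cellAt[L, u] \ slidingBox ℓ u,
          kinBoxN χ ℓ s b u (fun Z => Ψ.ψ ((split[S]).symm (Z, Y))) =
      kinLocN χ ℓ s b u L Ψ.ψ := by
  have hℓL : ℓ < L := by linarith
  have hL : 0 < L := hℓ.trans hℓL
  have hΨc : Continuous Ψ.ψ := Ψ.contDiff.continuous
  -- the slice forms `K i X = ⟨Ψ(X;·ᵢ), T_u Ψ(X;·ᵢ)⟩`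
  set K : Fin N → Config N → ℝ≥0∞ := fun i X => kinLoc χ ℓ s b u fun x => Ψ.ψ (Function.update X i x)
    with hKdef
  have hKm : ∀ i, Measurable (K i) := fun i => by
    have h := (measurable_kinLoc_slice hχ ℓ s b i hΨc).comp (measurable_prodMk_left (x := u))
    exact h
  have hKi : ∀ i X x, K i (Function.update X i x) = K i X := fun i X x => by
    simp only [hKdef, Function.update_idem]
  have hKper : ∀ (i : Fin N) (X : Config N) (j : Fin N) (k : Fin 3),
      K i (X + Pi.single j (EuclideanSpace.single k L)) = K i X := fun i X j k => by
    simp only [hKdef]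
    rw [Ψ.slice_add_single]
  -- measurability in `Y` of the `Z`-integrals
  have hYm : ∀ (S : Finset (Fin N)) (i : Fin N), Measurable fun Y : {i // i ∉ S} → Space =>
      ∫⁻ Z in boxConfig S.card ℓ u, K i ((split[S]).symm (Z, Y)) := fun S i => by
    have h := ((hKm i).comp (split[S]).symm.measurable).lintegral_prod_left'
      (μ := (volume : Measure (Config S.card)).restrict (boxConfig S.card ℓ u))
    exact h
  set I : Finset (Fin N) → Fin N → ℝ≥0∞ := fun S i =>
    ∫⁻ Y in Set.univ.pi fun _ : {i // i ∉ S} => cellAt[L, u] \ slidingBox ℓ u,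
      ∫⁻ Z in boxConfig S.card ℓ u, K i ((split[S]).symm (Z, Y)) with hIdef
  -- Step A–C: pull the finite sums and the constant out of the `Y`-integral
  have hA : ∀ S : Finset (Fin N),
      (∫⁻ Y in Set.univ.pi fun _ : {i // i ∉ S} => cellAt[L, u] \ slidingBox ℓ u,
          kinBoxN χ ℓ s b u (fun Z => Ψ.ψ ((split[S]).symm (Z, Y)))) =
        (ENNReal.ofReal ℓ ^ 3)⁻¹ * ∑ i, if i ∈ S then I S i else 0 := by
    intro S
    simp only [kinBoxN_split_symm]
    rw [lintegral_finsetSum _ fun j _ => (hYm S _).const_mul _]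
    simp only [lintegral_const_mul _ (hYm S _)]
    rw [← Finset.mul_sum, sum_eq_sum_enum S (G := fun i => if i ∈ S then I S i else 0)
      fun i hi => if_neg hi]
    congr 1
    refine Finset.sum_congr rfl fun j _ => ?_
    rw [if_pos (eS[S] j).2]
  simp only [hA]
  rw [← Finset.mul_sum, Finset.sum_comm]
  -- Step D–F: recombine the cells for each particle and count
  unfold kinLocN
  rw [Finset.mul_sum]
  refine Finset.sum_congr rfl fun i _ => ?_
  rw [← lintegral_pi_cellAt_indicator_eq_sum hℓL u (hKm i) i, kinetic_count hℓ hℓL u i (hKm i) (hKi i),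
    lintegral_pi_cellAt hL u (hKper i)]

end Chains

/-! ### Assembly: (3.17) from Theorem 2.1 -/

section Assembly

variable {N : ℕ} {L : ℝ}

/-- **Fournais 2020, (3.17) from Theorem 2.1.** The small-box bound [Fournais2020, Thm. 2.1]
(`Fournais2020_thm21`, first quantised on every particle-number sector of the box `Λ(u)`)
implies the display (3.17) on the torus: for `u ∈ Ω`, `2ℓ < L` (and `R ≤ ℓ`, forced by the
smallness of `ρ_μa³`), and every periodic `N`-body state `Ψ`,
`⟨Ψ, (∑ᵢ T_u^{(i)} + W_{u,N}) Ψ⟩ ≥ -4πρ_μ²aℓ³(1 + C₀(ρ_μa³)^{1/2})`, by decomposing `Ψ` on the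
shifted cell `Ω'(u)^N ⊇ Λ(u)^N` according to the set `S` of particles in `Λ(u)` and applying
Thm. 2.1 to each `Φ_{S,Y} = Ψ(·, Y)`, `Y ∈ (Ω' ∖ Λ)^{Sᶜ}` ("the natural identifications" (3.16)).
[cite: Fournais2020, (3.15)–(3.17), Thm. 2.1 (2.11)] -/
theorem Fournais2020_eq317_of_thm21 (h21 : Fournais2020_thm21) : Fournais2020_eq317 := by
  intro v hv hint ha ω hω χ hχ b s hb hs
  obtain ⟨hvmeas, R₀, hR₀⟩ := hv
  obtain ⟨K₀, hK₀, H21⟩ := h21 v ⟨hvmeas, R₀, hR₀⟩ hint ha ω hω χ hχ b s hb hs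
  refine ⟨K₀, hK₀, fun K hK => ?_⟩
  obtain ⟨C₀, c, hC₀, hc, H⟩ := H21 K hK
  have ha0 : 0 < (scatteringLength v).toReal := scatteringLength_toReal_pos hint ha
  have hKpos : 0 < K := hK₀.trans_le hK
  set R : ℝ := max R₀ 0 + 1 with hRdef
  have hRpos : 0 < R := by have := le_max_right R₀ 0; linarith
  have hR : ∀ r, R ≤ r → v r = 0 := fun r hr => hR₀ r (by have := le_max_left R₀ 0; linarith)
  refine ⟨C₀, min c ((R * K)⁻¹ ^ 2 * (scatteringLength v).toReal ^ 2), hC₀, lt_min hc (by positivity),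
    ?_⟩
  intro ρμ N L hρμ hL
  dsimp only
  intro hρc h2ℓ u hu Ψ
  set a : ℝ := (scatteringLength v).toReal with hadef
  set ℓ : ℝ := boxLength K ρμ a with hℓdef
  have hχc : Continuous χ := hχ.contDiff.continuous
  have hΨc : Continuous Ψ.ψ := Ψ.contDiff.continuous
  have hρc' : ρμ * a ^ 3 ≤ c := hρc.trans (min_le_left _ _)
  have hsq : 0 < Real.sqrt (ρμ * a) := Real.sqrt_pos.2 (by positivity)
  have hℓ0 : 0 < ℓ := by rw [hℓdef, boxLength]; positivity
  have hℓL : ℓ < L := by linarith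
  -- `R ≤ ℓ` from `ρ_μ a³ ≤ a²/(RK)²`
  have hRℓ : R ≤ ℓ := by
    have h1 : ρμ * a ≤ ((R * K)⁻¹) ^ 2 := by
      have h2 : ρμ * a ^ 3 ≤ (R * K)⁻¹ ^ 2 * a ^ 2 := hρc.trans (min_le_right _ _)
      have h3 : ρμ * a * a ^ 2 ≤ (R * K)⁻¹ ^ 2 * a ^ 2 := by nlinarith
      exact le_of_mul_le_mul_right h3 (by positivity)
    have h4 : Real.sqrt (ρμ * a) ≤ (R * K)⁻¹ := by
      rw [← Real.sqrt_sq (by positivity : 0 ≤ (R * K)⁻¹)]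
      exact Real.sqrt_le_sqrt h1
    rw [hℓdef, boxLength]
    rw [le_inv_comm₀ hRpos (by positivity)]
    calc K * Real.sqrt (ρμ * a) ≤ K * (R * K)⁻¹ := by gcongr
      _ = R⁻¹ := by field_simp
  -- Theorem 2.1 on the sectors of the box `Λ(u)`
  have HΦ : ∀ (M : ℕ) (Φ : Config M → ℂ), Measurable Φ →
      (∀ (σ : Equiv.Perm (Fin M)) (X : Config M), Φ (X ∘ σ) = Φ X) →
      (∫⁻ X in boxConfig M ℓ u, attrBoxN v ω χ ℓ ρμ u X * (‖Φ X‖₊ : ℝ≥0∞) ^ 2) ≤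
        kinBoxN χ ℓ s b u Φ +
          (∫⁻ X in boxConfig M ℓ u, repBoxN v χ ℓ u X * (‖Φ X‖₊ : ℝ≥0∞) ^ 2) +
          ENNReal.ofReal (4 * Real.pi * ρμ ^ 2 * a * ℓ ^ 3 * (1 + C₀ * (ρμ * a ^ 3) ^ (1 / 2 : ℝ))) *
            ∫⁻ X in boxConfig M ℓ u, (‖Φ X‖₊ : ℝ≥0∞) ^ 2 :=
    fun M Φ hΦm hΦs => H ρμ hρμ hρc' M u Φ hΦm hΦs
  -- notation
  set c₀ : ℝ≥0∞ :=
    ENNReal.ofReal (4 * Real.pi * ρμ ^ 2 * a * ℓ ^ 3 * (1 + C₀ * (ρμ * a ^ 3) ^ (1 / 2 : ℝ))) with hc₀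
  set Λ : Set Space := slidingBox ℓ u with hΛdef
  have hΛm : MeasurableSet Λ := measurableSet_slidingBox ℓ u
  have hBm : MeasurableSet (cellAt[L, u]) := measurableSet_cellAt L u
  have hEm : ∀ S : Finset (Fin N),
      MeasurableSet (Set.univ.pi fun _ : {i // i ∉ S} => cellAt[L, u] \ Λ) := fun S =>
    MeasurableSet.univ_pi fun _ => hBm.diff hΛm
  have hoff : ∀ (S : Finset (Fin N)) (Y : {i // i ∉ S} → Space),
      Y ∈ (Set.univ.pi fun _ : {i // i ∉ S} => cellAt[L, u] \ Λ) → ∀ i, Y i ∉ Λ :=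
    fun S Y hY i => (Set.mem_univ_pi.1 hY i).2
  have hnorm : Measurable fun X : Config N => (‖Ψ.ψ X‖₊ : ℝ≥0∞) ^ 2 := Ψ.measurable_normSq
  -- the three integrands on `Ω'^N` and their sector versions
  set Fa : Config N → ℝ≥0∞ := fun X => attrBoxN v ω χ ℓ ρμ u X * (‖Ψ.ψ X‖₊ : ℝ≥0∞) ^ 2 with hFa
  set Fr : Config N → ℝ≥0∞ := fun X => repBoxN v χ ℓ u X * (‖Ψ.ψ X‖₊ : ℝ≥0∞) ^ 2 with hFr
  set Fn : Config N → ℝ≥0∞ := fun X => (‖Ψ.ψ X‖₊ : ℝ≥0∞) ^ 2 with hFn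
  have hFam : Measurable Fa := (measurable_attrBoxN hvmeas hω.measurable hχ ℓ ρμ u).mul hnorm
  have hFrm : Measurable Fr := (measurable_repBoxN hvmeas hχ ℓ u).mul hnorm
  -- sector quantities
  set A : ∀ S : Finset (Fin N), ({i // i ∉ S} → Space) → ℝ≥0∞ := fun S Y =>
    ∫⁻ Z in boxConfig S.card ℓ u, attrBoxN v ω χ ℓ ρμ u Z *
      (‖Ψ.ψ ((split[S]).symm (Z, Y))‖₊ : ℝ≥0∞) ^ 2 with hA
  set Rr : ∀ S : Finset (Fin N), ({i // i ∉ S} → Space) → ℝ≥0∞ := fun S Y =>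
    ∫⁻ Z in boxConfig S.card ℓ u, repBoxN v χ ℓ u Z *
      (‖Ψ.ψ ((split[S]).symm (Z, Y))‖₊ : ℝ≥0∞) ^ 2 with hRr
  set Nm : ∀ S : Finset (Fin N), ({i // i ∉ S} → Space) → ℝ≥0∞ := fun S Y =>
    ∫⁻ Z in boxConfig S.card ℓ u, (‖Ψ.ψ ((split[S]).symm (Z, Y))‖₊ : ℝ≥0∞) ^ 2 with hNm
  set Kn : ∀ S : Finset (Fin N), ({i // i ∉ S} → Space) → ℝ≥0∞ := fun S Y =>
    kinBoxN χ ℓ s b u (fun Z => Ψ.ψ ((split[S]).symm (Z, Y))) with hKn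
  -- measurability in `Y`
  have hRrm : ∀ S, Measurable (Rr S) := fun S => by
    have h1 : Measurable fun q : Config S.card × ({i // i ∉ S} → Space) =>
        repBoxN v χ ℓ u q.1 * (‖Ψ.ψ ((split[S]).symm q)‖₊ : ℝ≥0∞) ^ 2 := by
      have h := ((measurable_repBoxN hvmeas hχ ℓ u).comp measurable_fst).mul
        (hnorm.comp (split[S]).symm.measurable)
      exact h
    have h := h1.lintegral_prod_left' (μ := (volume : Measure (Config S.card)).restrict (boxConfig S.card ℓ u))
    exact h
  have hNmm : ∀ S, Measurable (Nm S) := fun S => by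
    have h1 : Measurable fun q : Config S.card × ({i // i ∉ S} → Space) =>
        (‖Ψ.ψ ((split[S]).symm q)‖₊ : ℝ≥0∞) ^ 2 := by
      have h := hnorm.comp (split[S]).symm.measurable
      exact h
    have h := h1.lintegral_prod_left' (μ := (volume : Measure (Config S.card)).restrict (boxConfig S.card ℓ u))
    exact h
  have hKnm : ∀ S, Measurable (Kn S) := fun S => by
    simp only [hKn, kinBoxN_split_symm]
    refine Finset.measurable_sum _ fun j _ => Measurable.const_mul ?_ _
    have hK : Measurable fun X : Config N =>
        kinLoc χ ℓ s b u fun x => Ψ.ψ (Function.update X (eS[S] j) x) := by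
      have h := (measurable_kinLoc_slice hχc ℓ s b (eS[S] j) hΨc).comp (measurable_prodMk_left (x := u))
      exact h
    have h := (hK.comp (split[S]).symm.measurable).lintegral_prod_left'
      (μ := (volume : Measure (Config S.card)).restrict (boxConfig S.card ℓ u))
    exact h
  -- Theorem 2.1 sector by sector, integrated over `Y` and summed over `S`
  have hsec : ∀ S : Finset (Fin N),
      (∫⁻ Y in Set.univ.pi fun _ : {i // i ∉ S} => cellAt[L, u] \ Λ, A S Y) ≤
        (∫⁻ Y in Set.univ.pi fun _ : {i // i ∉ S} => cellAt[L, u] \ Λ, Kn S Y) +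
          (∫⁻ Y in Set.univ.pi fun _ : {i // i ∉ S} => cellAt[L, u] \ Λ, Rr S Y) +
          c₀ * ∫⁻ Y in Set.univ.pi fun _ : {i // i ∉ S} => cellAt[L, u] \ Λ, Nm S Y := by
    intro S
    have h1 : ∀ Y, A S Y ≤ Kn S Y + Rr S Y + c₀ * Nm S Y := fun Y =>
      HΦ S.card (fun Z => Ψ.ψ ((split[S]).symm (Z, Y)))
        (measurable_split_symm_left S hΨc.measurable Y) (symm_split_symm_left S Ψ.symm Y)
    calc (∫⁻ Y in Set.univ.pi fun _ : {i // i ∉ S} => cellAt[L, u] \ Λ, A S Y)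
        ≤ ∫⁻ Y in Set.univ.pi fun _ : {i // i ∉ S} => cellAt[L, u] \ Λ, (Kn S Y + Rr S Y + c₀ * Nm S Y) :=
          lintegral_mono h1
      _ = _ := by
          rw [lintegral_add_left (f := fun Y => Kn S Y + Rr S Y) ((hKnm S).add (hRrm S)),
            lintegral_add_left (hKnm S), lintegral_const_mul _ (hNmm S)]
  have hsum := Finset.sum_le_sum fun S (_ : S ∈ (Finset.univ : Finset (Finset (Fin N)))) => hsec S
  rw [Finset.sum_add_distrib, Finset.sum_add_distrib, ← Finset.mul_sum] at hsum
  -- identification of the four global quantities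
  -- (a) attraction
  have hattr : (∫⁻ X in cellN N L, attrLocN v ω χ ℓ L ρμ u X * (‖Ψ.ψ X‖₊ : ℝ≥0∞) ^ 2) =
      ∑ S, ∫⁻ Y in Set.univ.pi fun _ : {i // i ∉ S} => cellAt[L, u] \ Λ, A S Y := by
    rw [← lintegral_pi_cellAt hL u (G := fun X => attrLocN v ω χ ℓ L ρμ u X * (‖Ψ.ψ X‖₊ : ℝ≥0∞) ^ 2)
      fun X i k => by rw [attrLocN_add_single, Ψ.periodic]]
    rw [setLIntegral_congr_fun (MeasurableSet.univ_pi fun _ => hBm) (g := Fa) fun X hX => by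
      simp only [hFa]
      congr 1
      unfold attrLocN attrBoxN
      congr 1
      refine Finset.sum_congr rfl fun i _ => ?_
      exact lintegral_cell_pairLoc₁Per hχ hvmeas hR hω.measurable hℓ0 hRℓ h2ℓ
        (abs_sub_le_of_mem_cellAt (Set.mem_univ_pi.1 hX i))]
    rw [lintegral_pi_cellAt_eq_sum hℓL u hFam]
    refine Finset.sum_congr rfl fun S _ => setLIntegral_congr_fun (hEm S) fun Y hY => ?_
    simp only [hA, hFa]
    refine lintegral_congr fun Z => ?_
    rw [attrBoxN_split_symm hχ hℓ0 ρμ Z (hoff S Y hY)]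
  -- (b) repulsion
  have hrep : (∫⁻ X in cellN N L, repLocN v χ ℓ L u X * (‖Ψ.ψ X‖₊ : ℝ≥0∞) ^ 2) =
      ∑ S, ∫⁻ Y in Set.univ.pi fun _ : {i // i ∉ S} => cellAt[L, u] \ Λ, Rr S Y := by
    rw [← lintegral_pi_cellAt hL u (G := fun X => repLocN v χ ℓ L u X * (‖Ψ.ψ X‖₊ : ℝ≥0∞) ^ 2)
      fun X i k => by rw [repLocN_add_single, Ψ.periodic]]
    rw [setLIntegral_congr_fun (MeasurableSet.univ_pi fun _ => hBm) (g := Fr) fun X hX => by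
      simp only [hFr]
      congr 1
      unfold repLocN repBoxN
      refine Finset.sum_congr rfl fun i _ => Finset.sum_congr rfl fun j _ => ?_
      exact pairLocPer_eq_pairLoc hχ hR hℓ0 hRℓ h2ℓ
        (abs_sub_le_of_mem_cellAt (Set.mem_univ_pi.1 hX i))
        (abs_sub_le_of_mem_cellAt (Set.mem_univ_pi.1 hX j))]
    rw [lintegral_pi_cellAt_eq_sum hℓL u hFrm]
    refine Finset.sum_congr rfl fun S _ => setLIntegral_congr_fun (hEm S) fun Y hY => ?_
    simp only [hRr, hFr]
    refine lintegral_congr fun Z => ?_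
    rw [repBoxN_split_symm hχ hℓ0 Z (hoff S Y hY)]
  -- (c) normalisation
  have hone : ∑ S, (∫⁻ Y in Set.univ.pi fun _ : {i // i ∉ S} => cellAt[L, u] \ Λ, Nm S Y) = 1 := by
    rw [← Ψ.norm_eq, ← lintegral_pi_cellAt hL u (G := Fn) fun X i k => by simp only [hFn, Ψ.periodic],
      lintegral_pi_cellAt_eq_sum hℓL u hnorm]
  -- (d) kinetic energy
  have hkin : ∑ S, (∫⁻ Y in Set.univ.pi fun _ : {i // i ∉ S} => cellAt[L, u] \ Λ, Kn S Y) =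
      kinLocN χ ℓ s b u L Ψ.ψ :=
    sum_lintegral_kinBoxN_split hℓ0 h2ℓ hχc s b u Ψ
  rw [hattr]
  rw [hkin, ← hrep, hone, mul_one] at hsum
  exact hsum

end Assembly

end Literature.MathematicalPhysics.QuantumManyBody.BoseGas
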